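import Mathlib.RingTheory.Perfectoid.FontaineTheta
import HarnessLib

/-!
# The tilt of a `p`-adic ring with perfect residue ring, and the homomorphism `W(κ) → O`

Let `p` be a prime and `A` a commutative ring of characteristic `p` given with a surjection
`π : A → κ` onto a PERFECT ring `κ` whose kernel is nil of bounded exponent
(`π a = 0 → a ^ p ^ m = 0` for a fixed `m`; e.g. `A = O/p`, `κ = O/𝔪` for a discrete valuation
ring `O` of mixed characteristic with perfect residue field and absolute ramification index
`e ≤ p ^ m`). This file proves the two classical facts behind "`W(k̄) ⊆ 𝒪̂_{F^nr}`,
`W(k̄) ⊆ 𝔸_inf`" (Serre, *Local Fields*, Ch. II §4 Prop. 8 and §5 Prop. 10, Thm. 4), in the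
language of Mathlib's perfection / tilt / Fontaine `θ`:

* `frobeniusSection π … : κ →+* A` — **the unique ring-homomorphic section of `π`**
  (`π ∘ s = id`, `frobeniusSection_unique`): `s(y) = ỹ ^ (p ^ m)` for any lift `ỹ` of
  `y ^ (p ^ -m)` (Serre II §4 Prop. 8 (i), (iv): in characteristic `p` the multiplicative system of
  representatives is additive; here the Cauchy filter is eventually constant because the kernel is
  nil of bounded exponent, so no completeness is needed);
* `perfectionMap_frobeniusSection` — `s` exhibits `κ` as THE PERFECTION of `A` (Mathlib
  `PerfectionMap`), whence `residuePerfectionEquiv : κ ≃+* Perfection A p` with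
  `coeff n (equiv y) = s (y ^ (p ^ -n))`;
* for a `p`-adically complete `O` with `p ∉ Oˣ` and such a `π : O/p → κ`:
  `tiltEquivOfPerfectResidue : κ ≃+* PreTilt O p` (**the tilt of `O` is its perfect residue
  ring**) and `wittToRingOfPerfectResidue : 𝕎 κ →+* O`, Fontaine's `θ` transported along it —
  the homomorphism `g : W(κ) → O` of Serre II §5 Prop. 10 / Thm. 4 ("there exists a unique
  homomorphism of `W(k)` into `A` making the diagram commute"), with its defining property
  modulo `p` (`mk_wittToRingOfPerfectResidue`: `g(x) ≡ s(x₀) (mod p)`) and its value on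
  Teichmüller representatives (`wittToRingOfPerfectResidue_teichmuller`).

These are used in `Literature.NumberTheory.PAdicHodge` for `O = 𝒪̂_{F^nr}` (`κ = k̄`, giving
`W(k̄) → 𝒪̂_{F^nr}` and, by functoriality of the tilt along `𝒪̂_{F^nr} → 𝒪_{ℂ_F}`, the
`Γ_F`-equivariant embedding `W(k̄) → 𝔸_inf(F)`; Fontaine 1994, Exp. II §1.2).

## References
* [SerreLocalFields1979] J.-P. Serre, *Local Fields*, GTM 67, Ch. II §4 Prop. 8, §5 Prop. 10,
  Thm. 4, Thm. 5.
* [FontaineAsterisque223III] J.-M. Fontaine, *Le corps des périodes p-adiques*, Astérisque 223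
  (1994), Exp. II §1.2 (`W(k̄) ⊂ A_inf`).
-/

noncomputable section

open Ideal Perfection

namespace Literature.NumberTheory.PAdicHodge

/-! ### The Frobenius section of a nil-thickening of a perfect ring -/

section FrobeniusSection

variable {A : Type*} [CommRing A] {p : ℕ} [Fact p.Prime] [CharP A p]
  {κ : Type*} [CommRing κ] [CharP κ p] [PerfectRing κ p]
  {π : A →+* κ} (hπ : Function.Surjective π) {m : ℕ} (hnil : ∀ a, π a = 0 → a ^ p ^ m = 0)

omit [CharP κ p] [PerfectRing κ p] in
include hnil in
/-- If two elements of `A` have the same image in `κ`, their `p ^ m`-th powers agree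
(`(a + i) ^ (p ^ m) = a ^ (p ^ m) + i ^ (p ^ m)` in characteristic `p`, and `i ^ (p ^ m) = 0`).
[cite: SerreLocalFields1979, Ch. II §4 Lemma 1] -/
theorem pow_prime_pow_eq_of_apply_eq {a b : A} (h : π a = π b) : a ^ p ^ m = b ^ p ^ m := by
  have hi : π (a - b) = 0 := by rw [map_sub, h, sub_self]
  have := add_pow_char_pow b (a - b) p m
  rw [add_sub_cancel, hnil _ hi, add_zero] at this
  exact this

/-- The underlying function of the Frobenius section: `y ↦ ỹ ^ (p ^ m)` for a lift `ỹ` of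
`y ^ (p ^ -m)`. [cite: SerreLocalFields1979, Ch. II §4 Prop. 8] -/
def frobeniusSectionFun (hπ : Function.Surjective π) (m : ℕ) (y : κ) : A :=
  (Classical.choose (hπ ((iterateFrobeniusEquiv κ p m).symm y))) ^ p ^ m

include hnil in
/-- `frobeniusSectionFun` computed with ANY lift of `y ^ (p ^ -m)`. [folklore] -/
theorem frobeniusSectionFun_eq {y : κ} {a : A} (ha : π a = (iterateFrobeniusEquiv κ p m).symm y) :
    frobeniusSectionFun hπ m y = a ^ p ^ m := by
  unfold frobeniusSectionFun
  refine pow_prime_pow_eq_of_apply_eq hnil ?_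
  rw [Classical.choose_spec (hπ ((iterateFrobeniusEquiv κ p m).symm y)), ha]

include hnil in
/-- `π (s y) = y`. [cite: SerreLocalFields1979, Ch. II §4 Prop. 8] -/
theorem apply_frobeniusSectionFun (y : κ) : π (frobeniusSectionFun hπ m y) = y := by
  obtain ⟨a, ha⟩ := hπ ((iterateFrobeniusEquiv κ p m).symm y)
  rw [frobeniusSectionFun_eq hπ hnil ha, map_pow, ha, ← iterateFrobeniusEquiv_def,
    RingEquiv.apply_symm_apply]

variable (π m) in
include hnil in
/-- **The Frobenius section** `s : κ →+* A` of the nil-thickening `π : A → κ` of the perfect ring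
`κ`: the unique ring homomorphism with `π ∘ s = id` (Serre's multiplicative — here also additive,
`A` having characteristic `p` — system of representatives).
[cite: SerreLocalFields1979, Ch. II §4 Prop. 8] -/
def frobeniusSection : κ →+* A where
  toFun := frobeniusSectionFun hπ m
  map_one' := by
    rw [frobeniusSectionFun_eq hπ hnil (a := 1) (by rw [map_one, map_one]), one_pow]
  map_mul' x y := by
    obtain ⟨a, ha⟩ := hπ ((iterateFrobeniusEquiv κ p m).symm x)
    obtain ⟨b, hb⟩ := hπ ((iterateFrobeniusEquiv κ p m).symm y)
    rw [frobeniusSectionFun_eq hπ hnil ha, frobeniusSectionFun_eq hπ hnil hb,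
      frobeniusSectionFun_eq hπ hnil (a := a * b) (by rw [map_mul, ha, hb, map_mul]), mul_pow]
  map_zero' := by
    rw [frobeniusSectionFun_eq hπ hnil (a := 0) (by rw [map_zero, map_zero]),
      zero_pow (pow_ne_zero _ (Fact.out : p.Prime).ne_zero)]
  map_add' x y := by
    obtain ⟨a, ha⟩ := hπ ((iterateFrobeniusEquiv κ p m).symm x)
    obtain ⟨b, hb⟩ := hπ ((iterateFrobeniusEquiv κ p m).symm y)
    rw [frobeniusSectionFun_eq hπ hnil ha, frobeniusSectionFun_eq hπ hnil hb,
      frobeniusSectionFun_eq hπ hnil (a := a + b) (by rw [map_add, ha, hb, map_add]),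
      add_pow_char_pow]

/-- Unfolding of `frobeniusSection`. [folklore] -/
theorem frobeniusSection_apply (y : κ) : frobeniusSection π hπ m hnil y = frobeniusSectionFun hπ m y :=
  rfl

/-- `s y = a ^ (p ^ m)` for every lift `a` of `y ^ (p ^ -m)`. [folklore] -/
theorem frobeniusSection_eq_pow {y : κ} {a : A} (ha : π a = (iterateFrobeniusEquiv κ p m).symm y) :
    frobeniusSection π hπ m hnil y = a ^ p ^ m :=
  frobeniusSectionFun_eq hπ hnil ha

/-- **`π ∘ s = id`.** [cite: SerreLocalFields1979, Ch. II §4 Prop. 8] -/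
@[simp] theorem apply_frobeniusSection (y : κ) : π (frobeniusSection π hπ m hnil y) = y :=
  apply_frobeniusSectionFun hπ hnil y

/-- `π ∘ s = id` as ring homomorphisms. [folklore] -/
theorem comp_frobeniusSection : π.comp (frobeniusSection π hπ m hnil) = RingHom.id κ :=
  RingHom.ext (apply_frobeniusSection hπ hnil)

/-- `s` is injective. [folklore] -/
theorem frobeniusSection_injective : Function.Injective (frobeniusSection π hπ m hnil) :=
  fun x y h => by simpa using congrArg π h

/-- `s (π a) = a ^ (p ^ m)` whenever `π a` is already a `p ^ m`-th power of `π a'`… in the useful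
form: `s (π (a ^ (p ^ m))) = a ^ (p ^ m)`, i.e. `s ∘ π` is the identity on `p ^ m`-th powers.
[cite: SerreLocalFields1979, Ch. II §4 Prop. 8] -/
theorem frobeniusSection_apply_pow (a : A) :
    frobeniusSection π hπ m hnil (π (a ^ p ^ m)) = a ^ p ^ m :=
  frobeniusSection_eq_pow hπ hnil (by
    rw [map_pow, ← iterateFrobeniusEquiv_def, RingEquiv.symm_apply_apply])

/-- **Uniqueness of the section**: a ring homomorphism `s' : κ → A` with `π ∘ s' = id` is the
Frobenius section. [cite: SerreLocalFields1979, Ch. II §4 Prop. 8] -/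
theorem frobeniusSection_unique (s' : κ →+* A) (hs' : ∀ y, π (s' y) = y) :
    s' = frobeniusSection π hπ m hnil := by
  refine RingHom.ext fun y => ?_
  have hy : y = ((iterateFrobeniusEquiv κ p m).symm y) ^ p ^ m := by
    rw [← iterateFrobeniusEquiv_def, RingEquiv.apply_symm_apply]
  conv_lhs => rw [hy, map_pow]
  exact (frobeniusSection_eq_pow hπ hnil (hs' _)).symm

/-! ### `κ` is the perfection of `A` -/

omit [Fact p.Prime] [CharP A p] in
/-- In a tower `f (n + 1) ^ p = f n`, `f (n + k) ^ (p ^ k) = f n`. [folklore] -/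
theorem pow_prime_pow_eq_of_tower {f : ℕ → A} (hf : ∀ n, f (n + 1) ^ p = f n) (n k : ℕ) :
    f (n + k) ^ p ^ k = f n := by
  induction k with
  | zero => rw [pow_zero, pow_one, add_zero]
  | succ k ih => rw [pow_succ', pow_mul, ← add_assoc, hf, ih]

omit [CharP A p] in
/-- In `κ`, the inverse Frobenius iterates of `π (f 0)` along a tower are the `π (f n)`. [folklore] -/
theorem iterate_frobeniusEquiv_symm_apply_tower {f : ℕ → A} (hf : ∀ n, f (n + 1) ^ p = f n) (n : ℕ) :
    ((frobeniusEquiv κ p).symm)^[n] (π (f 0)) = π (f n) := by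
  induction n with
  | zero => rfl
  | succ n ih =>
    rw [Function.iterate_succ_apply', ih]
    apply (frobeniusEquiv κ p).injective
    rw [RingEquiv.apply_symm_apply, frobeniusEquiv_def, ← map_pow, hf]

/-- **`κ` is the perfection of `A` through the Frobenius section** (Mathlib `PerfectionMap`):
a `p`-power tower `(f n)` in `A` comes from `π (f 0) ∈ κ`, since `s (π (f n)) = f (n + m) ^ (p ^ m)
= f n`. [cite: SerreLocalFields1979, Ch. II §4 Prop. 8 (ii)] -/
theorem perfectionMap_frobeniusSection : PerfectionMap p (frobeniusSection π hπ m hnil) where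
  injective x y h := by simpa using congrArg π (h 0)
  surjective f hf := by
    refine ⟨π (f 0), fun n => ?_⟩
    rw [iterate_frobeniusEquiv_symm_apply_tower hf n]
    conv_rhs => rw [← pow_prime_pow_eq_of_tower hf n m]
    refine frobeniusSection_eq_pow hπ hnil (a := f (n + m)) ?_
    apply (iterateFrobeniusEquiv κ p m).injective
    rw [RingEquiv.apply_symm_apply, iterateFrobeniusEquiv_def, ← map_pow, pow_prime_pow_eq_of_tower hf]

variable (π m) in
/-- **`κ ≃ Perfection A p`**: the perfect residue ring IS the (inverse-limit) perfection of its
nil-thickening `A`. [cite: SerreLocalFields1979, Ch. II §4 Prop. 8] -/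
def residuePerfectionEquiv : κ ≃+* Perfection A p :=
  (perfectionMap_frobeniusSection hπ hnil).equiv

/-- Coefficients of `residuePerfectionEquiv y`: the `n`-th one is `s (y ^ (p ^ -n))`. [folklore] -/
@[simp] theorem coeff_residuePerfectionEquiv (y : κ) (n : ℕ) :
    Perfection.coeff A p n (residuePerfectionEquiv π hπ m hnil y) =
      frobeniusSection π hπ m hnil (((frobeniusEquiv κ p).symm)^[n] y) :=
  rfl

/-- The `0`-th coefficient of `residuePerfectionEquiv y` is `s y`. [folklore] -/
theorem coeff_zero_residuePerfectionEquiv (y : κ) :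
    Perfection.coeff A p 0 (residuePerfectionEquiv π hπ m hnil y) = frobeniusSection π hπ m hnil y :=
  rfl

/-- `π` of the `0`-th coefficient of `residuePerfectionEquiv y` is `y`. [folklore] -/
theorem apply_coeff_zero_residuePerfectionEquiv (y : κ) :
    π (Perfection.coeff A p 0 (residuePerfectionEquiv π hπ m hnil y)) = y :=
  apply_frobeniusSection hπ hnil y

/-- The inverse of `residuePerfectionEquiv` is `π ∘ coeff 0`. [folklore] -/
theorem residuePerfectionEquiv_symm_apply (f : Perfection A p) :
    (residuePerfectionEquiv π hπ m hnil).symm f = π (Perfection.coeff A p 0 f) := by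
  obtain ⟨y, rfl⟩ := (residuePerfectionEquiv π hπ m hnil).surjective f
  rw [RingEquiv.symm_apply_apply, apply_coeff_zero_residuePerfectionEquiv]

end FrobeniusSection

/-! ### The tilt of a `p`-adic ring with perfect residue ring, and `W(κ) → O` -/

section Tilt

variable {O : Type*} [CommRing O] {p : ℕ} [Fact p.Prime] [Fact (¬ IsUnit (p : O))]
  {κ : Type*} [CommRing κ] [CharP κ p] [PerfectRing κ p]
  {π : ModP O p →+* κ} (hπ : Function.Surjective π) {m : ℕ} (hnil : ∀ a, π a = 0 → a ^ p ^ m = 0)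

variable (π m) in
/-- **The tilt of `O` is its perfect residue ring**: `κ ≃+* PreTilt O p = lim_{x ↦ x^p} O/p`
when `O/p → κ` is a nil-thickening of bounded exponent of the perfect ring `κ`.
[cite: SerreLocalFields1979, Ch. II §4 Prop. 8] -/
def tiltEquivOfPerfectResidue : κ ≃+* PreTilt O p :=
  residuePerfectionEquiv π hπ m hnil

/-- Coefficients of the tilt element attached to `y ∈ κ`. [folklore] -/
@[simp] theorem coeff_tiltEquivOfPerfectResidue (y : κ) (n : ℕ) :
    PreTilt.coeff n (tiltEquivOfPerfectResidue π hπ m hnil y) =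
      frobeniusSection π hπ m hnil (((frobeniusEquiv κ p).symm)^[n] y) :=
  rfl

/-- `π (coeff 0 (tilt y)) = y`. [folklore] -/
theorem apply_coeff_zero_tiltEquivOfPerfectResidue (y : κ) :
    π (PreTilt.coeff 0 (tiltEquivOfPerfectResidue π hπ m hnil y)) = y :=
  apply_frobeniusSection hπ hnil y

/-- The inverse of `tiltEquivOfPerfectResidue` is `π ∘ coeff 0` ("reduce the `0`-th component
modulo the maximal ideal"). [folklore] -/
theorem tiltEquivOfPerfectResidue_symm_apply (x : PreTilt O p) :
    (tiltEquivOfPerfectResidue π hπ m hnil).symm x = π (PreTilt.coeff 0 x) :=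
  residuePerfectionEquiv_symm_apply hπ hnil x

variable [IsAdicComplete (Ideal.span {(p : O)}) O]

/-- The sharp (untilt) of the tilt element of `y` reduces to `s y` modulo `p`. [folklore] -/
theorem mk_untilt_tiltEquivOfPerfectResidue (y : κ) :
    Ideal.Quotient.mk (Ideal.span {(p : O)}) (PreTilt.untilt (tiltEquivOfPerfectResidue π hπ m hnil y)) =
      frobeniusSection π hπ m hnil y := by
  rw [PreTilt.mk_untilt_eq_coeff_zero]; rfl

variable (π m) in
/-- **The homomorphism `W(κ) → O`** (Serre, *Local Fields* II §5 Prop. 10 / Thm. 4: the unique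
homomorphism of the strict `p`-ring `W(κ)` into the `p`-ring `O` over the residue map): Fontaine's
`θ : 𝕎(O♭) → O` (Mathlib `fontaineTheta`) composed with `𝕎(κ ≃ O♭)`.
[cite: SerreLocalFields1979, Ch. II §5 Prop. 10 and Thm. 4] -/
def wittToRingOfPerfectResidue : WittVector p κ →+* O :=
  (WittVector.fontaineTheta O p).comp (WittVector.map (tiltEquivOfPerfectResidue π hπ m hnil).toRingHom)

/-- `W(κ) → O` on Teichmüller representatives: `[y] ↦ (tilt y)♯`, Serre's multiplicative
representative of `y`. [cite: SerreLocalFields1979, Ch. II §5 Prop. 10] -/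
theorem wittToRingOfPerfectResidue_teichmuller (y : κ) :
    wittToRingOfPerfectResidue π hπ m hnil (WittVector.teichmuller p y) =
      PreTilt.untilt (tiltEquivOfPerfectResidue π hπ m hnil y) := by
  unfold wittToRingOfPerfectResidue
  rw [RingHom.comp_apply, WittVector.map_teichmuller, RingEquiv.toRingHom_eq_coe, RingHom.coe_coe,
    WittVector.fontaineTheta_teichmuller]

/-- **`W(κ) → O` lifts the residue section**: `g(x) ≡ s(x₀) (mod p)`, i.e. the diagram
`W(κ) → O → O/p ← κ ← W(κ)` commutes. [cite: SerreLocalFields1979, Ch. II §5 Prop. 10] -/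
theorem mk_wittToRingOfPerfectResidue (x : WittVector p κ) :
    Ideal.Quotient.mk (Ideal.span {(p : O)}) (wittToRingOfPerfectResidue π hπ m hnil x) =
      frobeniusSection π hπ m hnil (x.coeff 0) := by
  unfold wittToRingOfPerfectResidue
  rw [RingHom.comp_apply, WittVector.mk_fontaineTheta, WittVector.map_coeff]
  rfl

/-- The residue of `g(x)` in `κ` is the `0`-th Witt component `x₀`. [cite: SerreLocalFields1979, Ch. II §5 Prop. 10] -/
theorem apply_mk_wittToRingOfPerfectResidue (x : WittVector p κ) :
    π (Ideal.Quotient.mk (Ideal.span {(p : O)}) (wittToRingOfPerfectResidue π hπ m hnil x)) = x.coeff 0 := by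
  rw [mk_wittToRingOfPerfectResidue, apply_frobeniusSection]

end Tilt

end Literature.NumberTheory.PAdicHodge

end
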